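import Literature.IUT.HodgeTheaters.TemperedCoveringsCor23ReducedOfSpecialFibre
import Literature.IUT.HodgeTheaters.TemperedCoveringsSlimnessKerForm
import Literature.IUT.HodgeTheaters.StableCurveTemperedDataOfSpecialFibreTower
import Literature.AnabelianGeometry.SemiGraphs.TemperedSpecialFibreTowerPiData
import HarnessLib

/-!
# [IUTchI] Cor. 2.3 (iii) at the GENUINE special-fibre TOWER: KER-LEVEL at the levels `Ĵ_i ∩ Δ̂_X`, (b) ⇒ (a)

Mochizuki, *Inter-universal Teichmüller theory I: construction of Hodge theaters*, kurims manuscript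
(May 2020), §2, Corollary 2.3 (i)–(iv) pp. 47–49, proof of (iii) p. 48 l. 36 – p. 49 l. 32
[cite: Mochizuki2012, Cor 2.3(iii) pp.47-49] (D-0012 claim key; series status DISPUTED; nothing of the
series is asserted here), over Mochizuki, *Semi-graphs of anabelioids*, Publ. RIMS **42** (2006),
Example 3.10 pp. 44–45 [cite: MochizukiSemiAnbd2006, Ex 3.10 pp.44-45].

PROOF-ONLY sequel (no definition, no new named fact; node `IUTchI:Cor2.3(iii)`, board holder
abc-iut-w4-d058, piece (α) of the lineage's plan; GAP-LEDGER G-w4d058-1).  The reduced binder list of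
Cor. 2.3 (i)–(iv) at the genuine 𝔛-datum `StableCurveTemperedData.ofSpecialFibre` is
`{h22, hH | ∅, hOutTp | (hK0, hHstab), hA′, hB′}` (`TemperedCoveringsCor23ReducedOfSpecialFibre`), where
`hA′`/`hB′` are the `ℍ`-free KER-LEVEL conclusions "every `α ∈ Δ̂_X` commuting with `W ∩ Ker(Δ̂_X ↠ Π̂_𝔾)`
lies in `W`" at EVERY normal open `W ⊆ Δ̂_X`, under the guards (a) / (b) of Cor. 2.3 (iii).  This file
reads them AT THE TOWER of abc-iut-L5-t11's `OfSpecialFibre.towerOfSpecialFibreTower` (p. 50 l. 27–33: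
the closures `Ĵ_i` of the "exhaustive sequence" `N_i` of [SemiAnbd] Ex. 3.10 in `Π̂_X`):

* A. `cor23iii_condA_of_condB` / `exists_prime_not_mem_of_finite` — print's guard (b) `Σ̂ = 𝔓𝔯𝔦𝔪𝔢𝔰`
  IMPLIES guard (a) "`Σ̂` contains a prime `l ∉ Σ ∪ {p}`" as soon as `Σ ∪ {p}` omits a prime, in
  particular for every FINITE `Σ` (the IUT application has `Σ = {l}`, [IUTchII] Prop. 2.2 p. 66): the
  (b)-binder, whose printed proof rests on [Tama2] Thm. 0.2 (v) (p. 49 l. 6–14, not kernelised), is then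
  REDUNDANT — print itself only invokes (b) "if condition (b) holds, but condition (a) does not hold"
  (p. 48 l. 40);
* B. generic, over any `StableCurveTemperedData` and any level data `Prop24Tower`: KER-LEVEL at the
  levels of a tower cofinal among open subgroups gives KER-LEVEL at every normal open `W`
  (`kerLevel_all_of_towerLevels`, abc-iut-L5-d5's `kerLevel_all_of_cofinal`);
* C. at the genuine datum: `cor23_i_to_iv_ofSpecialFibre_of_tower` — Cor. 2.3 (i)–(iv) AS TYPED from
  `{h22, hH, hOutTp, hcof, hA, hB}` with `hA`/`hB` the KER-LEVEL conclusions at the tower levels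
  `i : ℕ` ONLY (cofinality `hcof` of the `N_i` = abc-iut-L5-t11's reading of "exhaustive"); the variants
  `…_of_prime` (`hB` DROPPED when `Σ ∪ {p}` omits a prime), `…_of_piData` (`hcof := P.N_cofinal` and
  `hK0 := P.admissibleKer_normal_pi` from L3's origin-data record `SpecialFibreTower.PiData`, so the
  tempered descent atom is print's "`ℍ` is `G_k`-stable" in group form `hHstab`),
  `…_closureH_of_piData` (print's parameter `Π̂_ℍ :=` the closure of `Π^tp_ℍ`: binder list
  `{h22, hHstab, hA, hB}` over the record) and `…_closureH_of_piData_of_finite` (`Σ` finite, as in the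
  IUT application `Σ = {l}`: binder list `{h22, hHstab, hA}`).  The companion file `TemperedCoveringsCor23KerLevelOfTowerInputs`
  reduces KER-LEVEL at ONE level `Ĵ_i ∩ Δ̂_X` of the genuine datum to EXACTLY the printed per-level inputs
  of `mem_level_of_comm_ker_of_inputs`, every structural side condition discharged.

NET READING of node `IUTchI:Cor2.3(iii)` at the genuine datum over a `PiData` record: Cor. 2.3 (i)–(iv)
AS TYPED ⇐ `h22` (Prop. 2.2 for the special-fibre 𝔾-data), "`ℍ` is `G_k`-stable" (`hHstab`), and, at each
tower level `i`, the printed per-level inputs of p. 48 l. 44 – p. 49 l. 32 (the companion file's list) —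
the open content of G-w4d058-1; nothing here discharges them.  Model-relative; typed ≠ discharged;
nothing here bears on [IUTchIII] Cor. 3.12.
-/

noncomputable section

namespace Literature.IUT.HodgeTheaters

open _root_.Topology
open scoped Pointwise
open Literature.AnabelianGeometry.SemiGraphs
open Literature.AlgebraicGeometry.Frobenioids (IsSlimGroup)

/-! ### A. Guard (b) implies guard (a) as soon as `Σ ∪ {p}` omits a prime -/

/-- **Cor. 2.3 (iii): condition (b) "`Σ̂ = 𝔓𝔯𝔦𝔪𝔢𝔰`" implies condition (a) "`Σ̂` contains a prime
`l ∉ Σ ∪ {p}`" whenever some prime lies outside `Σ ∪ {p}`** — so that print's [Tama2] branch ("if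
condition (b) holds, but condition (a) does not hold", p. 48 l. 40) is never entered for such `Σ`.
[cite: Mochizuki2012, Cor 2.3(iii) p.47] -/
theorem cor23iii_condA_of_condB {Sigma SigmaHat : Set ℕ} {p : ℕ}
    (hq : ∃ q, q.Prime ∧ q ∉ Sigma ∧ q ≠ p) (hb : SigmaHat = {q | q.Prime}) :
    ∃ l ∈ SigmaHat, l ∉ Sigma ∧ l ≠ p := by
  obtain ⟨q, hqP, hqS, hqp⟩ := hq
  subst hb
  exact ⟨q, hqP, hqS, hqp⟩

/-- A FINITE set of primes `Σ` together with `p` omits some prime (Euclid) — the IUT case `Σ = {l}`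
([IUTchII] Prop. 2.2). [cite: Mochizuki2012, Cor 2.3(iii) p.47] -/
theorem exists_prime_not_mem_of_finite {Sigma : Set ℕ} (hfin : Sigma.Finite) (p : ℕ) :
    ∃ q, q.Prime ∧ q ∉ Sigma ∧ q ≠ p := by
  obtain ⟨q, hge, hqP⟩ := Nat.exists_infinite_primes (hfin.toFinset.sup id + p + 1)
  refine ⟨q, hqP, fun hqS => ?_, by omega⟩
  have hle : q ≤ hfin.toFinset.sup id := Finset.le_sup (f := id) (hfin.mem_toFinset.mpr hqS)
  omega

/-! ### B. Generic: KER-LEVEL at the levels of a `Prop24Tower` -/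

namespace StableCurveTemperedData

universe u

section Generic

variable (D : StableCurveTemperedData.{u}) (T : D.Prop24Tower)

/-- **KER-LEVEL at the levels `Ĵ_i ∩ Δ̂_X` of a tower cofinal among the open subgroups of `Δ̂_X` gives
KER-LEVEL at EVERY normal open `W ⊆ Δ̂_X`** (the binder shape `hA′`/`hB′` of the reduced Cor. 2.3
assembly): abc-iut-L5-d5's `kerLevel_all_of_cofinal` at the tower levels.
[cite: Mochizuki2012, Cor 2.3(iii) p.48] -/
theorem kerLevel_all_of_towerLevels (hcof : T.LevelsCofinal)
    (hlev : ∀ i (a : D.DeltaHat),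
      (∀ x ∈ (T.Jhat i).subgroupOf D.DeltaHat, x ∈ D.ρHat.ker → a * x = x * a) →
        a ∈ (T.Jhat i).subgroupOf D.DeltaHat) :
    ∀ W : Subgroup D.DeltaHat, W.Normal → IsOpen (W : Set D.DeltaHat) →
      ∀ a : D.DeltaHat, (∀ x ∈ W, x ∈ D.ρHat.ker → a * x = x * a) → a ∈ W := by
  intro W _ hWo a ha
  obtain ⟨i, hi⟩ := hcof W hWo
  exact hi (hlev i a fun x hx hxK => ha x (hi hx) hxK)

end Generic

/-! ### C. At the genuine 𝔛-datum `ofSpecialFibre`, tower `towerOfSpecialFibreTower` -/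

section Genuine

variable {p : ℕ} [Fact p.Prime] (X : TemperedCurve p) (d : X.GroupLevelData)
  (S : SpecialFibreData (X.toTemperedArithmeticGroup d)) (h36 : S.Gc.Prop36Hypotheses)
  (Sigma SigmaHat : Set ℕ) (hsub : Sigma ⊆ SigmaHat) (hne : Sigma.Nonempty)
  (hprime : ∀ q ∈ SigmaHat, q.Prime) (hp : p ∉ Sigma)
  (TpH : Subgroup S.chart.G)
  (HatH : Subgroup (TemperedGraphGroupData.exists_completion_of_prop36 S.Gc h36 S.chart).choose)
  (hle : TpH.map (TemperedGraphGroupData.exists_completion_of_prop36 S.Gc h36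
    S.chart).choose_spec.choose.toMonoidHom ≤ HatH)
  (cuspMeetsH : {x : X.Pt // X.IsCusp x} → Prop)
  (T : SpecialFibreTower X.DeltaTemp)

/-- **At the genuine datum, KER-LEVEL at the tower levels `Ĵ_i ∩ Δ̂_X` (`i : ℕ`) gives KER-LEVEL at every
normal open `W ⊆ Δ̂_X`** — the binder shape `hA′`/`hB′` of `cor23_i_to_iv_ofSpecialFibre_reduced'` from
its tower-level instances. [cite: Mochizuki2012, Cor 2.3(iii) p.48] -/
theorem kerLevel_all_ofSpecialFibre_of_towerLevels
    (hcof : ∀ U : Subgroup X.DeltaTemp, IsOpen (U : Set X.DeltaTemp) → U.Normal → U.FiniteIndex →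
      ∃ i, T.N i ≤ U)
    (hlev : ∀ (i : ℕ) (a : (ofSpecialFibre X d S h36 Sigma SigmaHat hsub hne hprime hp TpH HatH hle
        cuspMeetsH).DeltaHat),
      (∀ x ∈ ((OfSpecialFibre.towerOfSpecialFibreTower X d T Sigma SigmaHat hsub hne hprime S h36 hp TpH
          HatH hle cuspMeetsH).Jhat i).subgroupOf
            (ofSpecialFibre X d S h36 Sigma SigmaHat hsub hne hprime hp TpH HatH hle cuspMeetsH).DeltaHat,
        x ∈ (ofSpecialFibre X d S h36 Sigma SigmaHat hsub hne hprime hp TpH HatH hle cuspMeetsH).ρHat.ker →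
          a * x = x * a) →
      a ∈ ((OfSpecialFibre.towerOfSpecialFibreTower X d T Sigma SigmaHat hsub hne hprime S h36 hp TpH
          HatH hle cuspMeetsH).Jhat i).subgroupOf
        (ofSpecialFibre X d S h36 Sigma SigmaHat hsub hne hprime hp TpH HatH hle cuspMeetsH).DeltaHat) :
    ∀ W : Subgroup (ofSpecialFibre X d S h36 Sigma SigmaHat hsub hne hprime hp TpH HatH hle cuspMeetsH).DeltaHat,
      W.Normal → IsOpen (W : Set (ofSpecialFibre X d S h36 Sigma SigmaHat hsub hne hprime hp TpH HatH hle
        cuspMeetsH).DeltaHat) →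
      ∀ a : (ofSpecialFibre X d S h36 Sigma SigmaHat hsub hne hprime hp TpH HatH hle cuspMeetsH).DeltaHat,
        (∀ x ∈ W, x ∈ (ofSpecialFibre X d S h36 Sigma SigmaHat hsub hne hprime hp TpH HatH hle
          cuspMeetsH).ρHat.ker → a * x = x * a) → a ∈ W :=
  kerLevel_all_of_towerLevels (ofSpecialFibre X d S h36 Sigma SigmaHat hsub hne hprime hp TpH HatH hle cuspMeetsH)
    (OfSpecialFibre.towerOfSpecialFibreTower X d T Sigma SigmaHat hsub hne hprime S h36 hp TpH HatH hle
      cuspMeetsH)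
    (OfSpecialFibre.towerOfSpecialFibreTower_levelsCofinal X d T Sigma SigmaHat hsub hne hprime S h36 hp TpH
      HatH hle cuspMeetsH hcof)
    hlev

/-! #### The per-level binders at the tower, as section hypotheses -/

variable
  (hcof : ∀ U : Subgroup X.DeltaTemp, IsOpen (U : Set X.DeltaTemp) → U.Normal → U.FiniteIndex →
    ∃ i, T.N i ≤ U)
  (hA : (∃ l ∈ SigmaHat, l ∉ Sigma ∧ l ≠ p) →
    ∀ (i : ℕ) (a : (ofSpecialFibre X d S h36 Sigma SigmaHat hsub hne hprime hp TpH HatH hle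
        cuspMeetsH).DeltaHat),
      (∀ x ∈ ((OfSpecialFibre.towerOfSpecialFibreTower X d T Sigma SigmaHat hsub hne hprime S h36 hp TpH
          HatH hle cuspMeetsH).Jhat i).subgroupOf
            (ofSpecialFibre X d S h36 Sigma SigmaHat hsub hne hprime hp TpH HatH hle cuspMeetsH).DeltaHat,
        x ∈ (ofSpecialFibre X d S h36 Sigma SigmaHat hsub hne hprime hp TpH HatH hle cuspMeetsH).ρHat.ker →
          a * x = x * a) →
      a ∈ ((OfSpecialFibre.towerOfSpecialFibreTower X d T Sigma SigmaHat hsub hne hprime S h36 hp TpH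
          HatH hle cuspMeetsH).Jhat i).subgroupOf
        (ofSpecialFibre X d S h36 Sigma SigmaHat hsub hne hprime hp TpH HatH hle cuspMeetsH).DeltaHat)
  (hB : SigmaHat = {q | q.Prime} →
    ∀ (i : ℕ) (a : (ofSpecialFibre X d S h36 Sigma SigmaHat hsub hne hprime hp TpH HatH hle
        cuspMeetsH).DeltaHat),
      (∀ x ∈ ((OfSpecialFibre.towerOfSpecialFibreTower X d T Sigma SigmaHat hsub hne hprime S h36 hp TpH
          HatH hle cuspMeetsH).Jhat i).subgroupOf
            (ofSpecialFibre X d S h36 Sigma SigmaHat hsub hne hprime hp TpH HatH hle cuspMeetsH).DeltaHat,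
        x ∈ (ofSpecialFibre X d S h36 Sigma SigmaHat hsub hne hprime hp TpH HatH hle cuspMeetsH).ρHat.ker →
          a * x = x * a) →
      a ∈ ((OfSpecialFibre.towerOfSpecialFibreTower X d T Sigma SigmaHat hsub hne hprime S h36 hp TpH
          HatH hle cuspMeetsH).Jhat i).subgroupOf
        (ofSpecialFibre X d S h36 Sigma SigmaHat hsub hne hprime hp TpH HatH hle cuspMeetsH).DeltaHat)
  (h22 : (ofSpecialFibre X d S h36 Sigma SigmaHat hsub hne hprime hp TpH HatH hle
    cuspMeetsH).graph.CommensuratorsOfDecompositionSubgroups)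
  (hH : ((ofSpecialFibre X d S h36 Sigma SigmaHat hsub hne hprime hp TpH HatH hle cuspMeetsH).graph.HatH :
      Set (ofSpecialFibre X d S h36 Sigma SigmaHat hsub hne hprime hp TpH HatH hle cuspMeetsH).graph.Hat) =
    closure ((ofSpecialFibre X d S h36 Sigma SigmaHat hsub hne hprime hp TpH HatH hle cuspMeetsH).graph.ι ''
      (ofSpecialFibre X d S h36 Sigma SigmaHat hsub hne hprime hp TpH HatH hle cuspMeetsH).graph.TpH))
  (hOutTp : ∀ g : (ofSpecialFibre X d S h36 Sigma SigmaHat hsub hne hprime hp TpH HatH hle cuspMeetsH).PiTp,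
    ∃ δ : (ofSpecialFibre X d S h36 Sigma SigmaHat hsub hne hprime hp TpH HatH hle cuspMeetsH).DeltaTp,
      MulAut.conj g • ((ofSpecialFibre X d S h36 Sigma SigmaHat hsub hne hprime hp TpH HatH hle
          cuspMeetsH).deltaTpH.map
        (ofSpecialFibre X d S h36 Sigma SigmaHat hsub hne hprime hp TpH HatH hle cuspMeetsH).DeltaTp.subtype) =
      MulAut.conj (δ : (ofSpecialFibre X d S h36 Sigma SigmaHat hsub hne hprime hp TpH HatH hle
          cuspMeetsH).PiTp) •
        ((ofSpecialFibre X d S h36 Sigma SigmaHat hsub hne hprime hp TpH HatH hle cuspMeetsH).deltaTpH.map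
          (ofSpecialFibre X d S h36 Sigma SigmaHat hsub hne hprime hp TpH HatH hle cuspMeetsH).DeltaTp.subtype))
  (hq : ∃ q, q.Prime ∧ q ∉ Sigma ∧ q ≠ p)

include hcof hA hB h22 hH hOutTp in
/-- **[IUTchI] Cor. 2.3 (i)–(iv) AS TYPED at the genuine 𝔛-datum, KER-LEVEL READ AT THE TOWER**: from
Prop. 2.2 for the special-fibre 𝔾-data (`h22`), `Π̂_ℍ =` closure of `Π^tp_ℍ` (`hH`), the tempered descent
atom (`hOutTp`), the cofinality of the `N_i` (`hcof`) and the KER-LEVEL conclusions at the tower levels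
`Ĵ_i ∩ Δ̂_X`, `i : ℕ`, under (a) (`hA`) / (b) (`hB`) — `cor23_i_to_iv_ofSpecialFibre_reduced'` with its
all-normal-open binders `hA′`/`hB′` supplied by `kerLevel_all_ofSpecialFibre_of_towerLevels`.
[cite: Mochizuki2012, Cor 2.3 pp.47-49] -/
theorem cor23_i_to_iv_ofSpecialFibre_of_tower :
    (ofSpecialFibre X d S h36 Sigma SigmaHat hsub hne hprime hp TpH HatH hle cuspMeetsH).Cor23i ∧
      (ofSpecialFibre X d S h36 Sigma SigmaHat hsub hne hprime hp TpH HatH hle cuspMeetsH).Cor23ii ∧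
      (ofSpecialFibre X d S h36 Sigma SigmaHat hsub hne hprime hp TpH HatH hle cuspMeetsH).Cor23iii ∧
      (ofSpecialFibre X d S h36 Sigma SigmaHat hsub hne hprime hp TpH HatH hle cuspMeetsH).Cor23iv :=
  cor23_i_to_iv_ofSpecialFibre_reduced' X d S h36 Sigma SigmaHat hsub hne hprime hp TpH HatH hle cuspMeetsH
    h22 hH hOutTp
    (fun ha => kerLevel_all_ofSpecialFibre_of_towerLevels X d S h36 Sigma SigmaHat hsub hne hprime hp TpH
      HatH hle cuspMeetsH T hcof (hA ha))
    (fun hb => kerLevel_all_ofSpecialFibre_of_towerLevels X d S h36 Sigma SigmaHat hsub hne hprime hp TpH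
      HatH hle cuspMeetsH T hcof (hB hb))

include hcof hA h22 hH hOutTp hq in
/-- **The same with the (b)-binder DROPPED**: if `Σ ∪ {p}` omits a prime (`hq`; every finite `Σ`,
`exists_prime_not_mem_of_finite`), guard (b) implies guard (a) (`cor23iii_condA_of_condB`), so the
KER-LEVEL conclusions are only needed under (a) — Cor. 2.3 (i)–(iv) AS TYPED from
`{h22, hH, hOutTp, hcof, hA}`. [cite: Mochizuki2012, Cor 2.3 pp.47-49] -/
theorem cor23_i_to_iv_ofSpecialFibre_of_tower_of_prime :
    (ofSpecialFibre X d S h36 Sigma SigmaHat hsub hne hprime hp TpH HatH hle cuspMeetsH).Cor23i ∧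
      (ofSpecialFibre X d S h36 Sigma SigmaHat hsub hne hprime hp TpH HatH hle cuspMeetsH).Cor23ii ∧
      (ofSpecialFibre X d S h36 Sigma SigmaHat hsub hne hprime hp TpH HatH hle cuspMeetsH).Cor23iii ∧
      (ofSpecialFibre X d S h36 Sigma SigmaHat hsub hne hprime hp TpH HatH hle cuspMeetsH).Cor23iv :=
  cor23_i_to_iv_ofSpecialFibre_of_tower X d S h36 Sigma SigmaHat hsub hne hprime hp TpH HatH hle cuspMeetsH T
    hcof hA (fun hb => hA (cor23iii_condA_of_condB hq hb)) h22 hH hOutTp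

/-- **[IUTchI] Cor. 2.3 (i)–(iv) AS TYPED at the genuine datum OVER L3's ORIGIN-DATA RECORD
`SpecialFibreTower.PiData`** ([SemiAnbd] Ex. 3.10 with its `Π`-equivariant structure, abc-iut-L3-t2):
the cofinality of the `N_i` is the record's `N_cofinal`, (P0)₀ is its `admissibleKer_normal_pi`; what
remains is `h22`, `hH`, "`ℍ` is `G_k`-stable" for the parameter `Π^tp_ℍ` (`hHstab`) and the KER-LEVEL
conclusions at the tower levels under (a)/(b). [cite: Mochizuki2012, Cor 2.3 pp.47-49] -/
theorem cor23_i_to_iv_ofSpecialFibre_of_piData (P : SpecialFibreTower.PiData X d S T)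
    (hA : (∃ l ∈ SigmaHat, l ∉ Sigma ∧ l ≠ p) →
      ∀ (i : ℕ) (a : (ofSpecialFibre X d S h36 Sigma SigmaHat hsub hne hprime hp TpH HatH hle
          cuspMeetsH).DeltaHat),
        (∀ x ∈ ((OfSpecialFibre.towerOfSpecialFibreTower X d T Sigma SigmaHat hsub hne hprime S h36 hp TpH
            HatH hle cuspMeetsH).Jhat i).subgroupOf
              (ofSpecialFibre X d S h36 Sigma SigmaHat hsub hne hprime hp TpH HatH hle cuspMeetsH).DeltaHat,
          x ∈ (ofSpecialFibre X d S h36 Sigma SigmaHat hsub hne hprime hp TpH HatH hle cuspMeetsH).ρHat.ker →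
            a * x = x * a) →
        a ∈ ((OfSpecialFibre.towerOfSpecialFibreTower X d T Sigma SigmaHat hsub hne hprime S h36 hp TpH
            HatH hle cuspMeetsH).Jhat i).subgroupOf
          (ofSpecialFibre X d S h36 Sigma SigmaHat hsub hne hprime hp TpH HatH hle cuspMeetsH).DeltaHat)
    (hB : SigmaHat = {q | q.Prime} →
      ∀ (i : ℕ) (a : (ofSpecialFibre X d S h36 Sigma SigmaHat hsub hne hprime hp TpH HatH hle
          cuspMeetsH).DeltaHat),
        (∀ x ∈ ((OfSpecialFibre.towerOfSpecialFibreTower X d T Sigma SigmaHat hsub hne hprime S h36 hp TpH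
            HatH hle cuspMeetsH).Jhat i).subgroupOf
              (ofSpecialFibre X d S h36 Sigma SigmaHat hsub hne hprime hp TpH HatH hle cuspMeetsH).DeltaHat,
          x ∈ (ofSpecialFibre X d S h36 Sigma SigmaHat hsub hne hprime hp TpH HatH hle cuspMeetsH).ρHat.ker →
            a * x = x * a) →
        a ∈ ((OfSpecialFibre.towerOfSpecialFibreTower X d T Sigma SigmaHat hsub hne hprime S h36 hp TpH
            HatH hle cuspMeetsH).Jhat i).subgroupOf
          (ofSpecialFibre X d S h36 Sigma SigmaHat hsub hne hprime hp TpH HatH hle cuspMeetsH).DeltaHat)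
    (h22 : (ofSpecialFibre X d S h36 Sigma SigmaHat hsub hne hprime hp TpH HatH hle
      cuspMeetsH).graph.CommensuratorsOfDecompositionSubgroups)
    (hH : ((ofSpecialFibre X d S h36 Sigma SigmaHat hsub hne hprime hp TpH HatH hle cuspMeetsH).graph.HatH :
        Set (ofSpecialFibre X d S h36 Sigma SigmaHat hsub hne hprime hp TpH HatH hle cuspMeetsH).graph.Hat) =
      closure ((ofSpecialFibre X d S h36 Sigma SigmaHat hsub hne hprime hp TpH HatH hle cuspMeetsH).graph.ι ''
        (ofSpecialFibre X d S h36 Sigma SigmaHat hsub hne hprime hp TpH HatH hle cuspMeetsH).graph.TpH))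
    (hHstab : ∀ g : X.PiTemp, ∃ t : S.chart.G,
      TpH.map (S.autOfConj P.admissibleKer_normal_pi g).toMulEquiv.toMonoidHom = MulAut.conj t • TpH) :
    (ofSpecialFibre X d S h36 Sigma SigmaHat hsub hne hprime hp TpH HatH hle cuspMeetsH).Cor23i ∧
      (ofSpecialFibre X d S h36 Sigma SigmaHat hsub hne hprime hp TpH HatH hle cuspMeetsH).Cor23ii ∧
      (ofSpecialFibre X d S h36 Sigma SigmaHat hsub hne hprime hp TpH HatH hle cuspMeetsH).Cor23iii ∧
      (ofSpecialFibre X d S h36 Sigma SigmaHat hsub hne hprime hp TpH HatH hle cuspMeetsH).Cor23iv :=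
  cor23_i_to_iv_ofSpecialFibre_of_tower X d S h36 Sigma SigmaHat hsub hne hprime hp TpH HatH hle cuspMeetsH T
    P.N_cofinal hA hB h22 hH
    (ofSpecialFibre_outerTp_of_graphStable X d S h36 Sigma SigmaHat hsub hne hprime hp TpH HatH hle cuspMeetsH
      P.admissibleKer_normal_pi hHstab)

/-- **[IUTchI] Cor. 2.3 (i)–(iv) AS TYPED at the genuine datum with PRINT's parameter `Π̂_ℍ :=` the closure
of `Π^tp_ℍ`, over the `PiData` record, KER-LEVEL read at the tower**: binder list `{h22, hHstab, hA, hB}` —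
Prop. 2.2 for the special-fibre 𝔾-data, "`ℍ` is `G_k`-stable" (group form, over the record's (P0)₀), and
the KER-LEVEL conclusions at the tower levels `Ĵ_i ∩ Δ̂_X` under (a)/(b); `hH`, `hker`, `hOutHat`,
`hOutTp`, `hK0`, `hcof` are all theorems / record fields here
(`cor23_i_to_iv_ofSpecialFibre_closureH_of_graphStable`). [cite: Mochizuki2012, Cor 2.3 pp.47-49] -/
theorem cor23_i_to_iv_ofSpecialFibre_closureH_of_piData (P : SpecialFibreTower.PiData X d S T)
    (hA : (∃ l ∈ SigmaHat, l ∉ Sigma ∧ l ≠ p) →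
      ∀ (i : ℕ) (a : (ofSpecialFibre X d S h36 Sigma SigmaHat hsub hne hprime hp TpH
      ((TpH.map (TemperedGraphGroupData.exists_completion_of_prop36 S.Gc h36
        S.chart).choose_spec.choose.toMonoidHom).topologicalClosure) (Subgroup.le_topologicalClosure _) cuspMeetsH).DeltaHat),
        (∀ x ∈ ((OfSpecialFibre.towerOfSpecialFibreTower X d T Sigma SigmaHat hsub hne hprime S h36 hp TpH
        ((TpH.map (TemperedGraphGroupData.exists_completion_of_prop36 S.Gc h36
          S.chart).choose_spec.choose.toMonoidHom).topologicalClosure) (Subgroup.le_topologicalClosure _)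
        cuspMeetsH).Jhat i).subgroupOf (ofSpecialFibre X d S h36 Sigma SigmaHat hsub hne hprime hp TpH
      ((TpH.map (TemperedGraphGroupData.exists_completion_of_prop36 S.Gc h36
        S.chart).choose_spec.choose.toMonoidHom).topologicalClosure) (Subgroup.le_topologicalClosure _) cuspMeetsH).DeltaHat,
          x ∈ (ofSpecialFibre X d S h36 Sigma SigmaHat hsub hne hprime hp TpH
      ((TpH.map (TemperedGraphGroupData.exists_completion_of_prop36 S.Gc h36
        S.chart).choose_spec.choose.toMonoidHom).topologicalClosure) (Subgroup.le_topologicalClosure _) cuspMeetsH).ρHat.ker → a * x = x * a) →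
        a ∈ ((OfSpecialFibre.towerOfSpecialFibreTower X d T Sigma SigmaHat hsub hne hprime S h36 hp TpH
        ((TpH.map (TemperedGraphGroupData.exists_completion_of_prop36 S.Gc h36
          S.chart).choose_spec.choose.toMonoidHom).topologicalClosure) (Subgroup.le_topologicalClosure _)
        cuspMeetsH).Jhat i).subgroupOf (ofSpecialFibre X d S h36 Sigma SigmaHat hsub hne hprime hp TpH
      ((TpH.map (TemperedGraphGroupData.exists_completion_of_prop36 S.Gc h36
        S.chart).choose_spec.choose.toMonoidHom).topologicalClosure) (Subgroup.le_topologicalClosure _) cuspMeetsH).DeltaHat)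
    (hB : SigmaHat = {q | q.Prime} →
      ∀ (i : ℕ) (a : (ofSpecialFibre X d S h36 Sigma SigmaHat hsub hne hprime hp TpH
      ((TpH.map (TemperedGraphGroupData.exists_completion_of_prop36 S.Gc h36
        S.chart).choose_spec.choose.toMonoidHom).topologicalClosure) (Subgroup.le_topologicalClosure _) cuspMeetsH).DeltaHat),
        (∀ x ∈ ((OfSpecialFibre.towerOfSpecialFibreTower X d T Sigma SigmaHat hsub hne hprime S h36 hp TpH
        ((TpH.map (TemperedGraphGroupData.exists_completion_of_prop36 S.Gc h36
          S.chart).choose_spec.choose.toMonoidHom).topologicalClosure) (Subgroup.le_topologicalClosure _)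
        cuspMeetsH).Jhat i).subgroupOf (ofSpecialFibre X d S h36 Sigma SigmaHat hsub hne hprime hp TpH
      ((TpH.map (TemperedGraphGroupData.exists_completion_of_prop36 S.Gc h36
        S.chart).choose_spec.choose.toMonoidHom).topologicalClosure) (Subgroup.le_topologicalClosure _) cuspMeetsH).DeltaHat,
          x ∈ (ofSpecialFibre X d S h36 Sigma SigmaHat hsub hne hprime hp TpH
      ((TpH.map (TemperedGraphGroupData.exists_completion_of_prop36 S.Gc h36
        S.chart).choose_spec.choose.toMonoidHom).topologicalClosure) (Subgroup.le_topologicalClosure _) cuspMeetsH).ρHat.ker → a * x = x * a) →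
        a ∈ ((OfSpecialFibre.towerOfSpecialFibreTower X d T Sigma SigmaHat hsub hne hprime S h36 hp TpH
        ((TpH.map (TemperedGraphGroupData.exists_completion_of_prop36 S.Gc h36
          S.chart).choose_spec.choose.toMonoidHom).topologicalClosure) (Subgroup.le_topologicalClosure _)
        cuspMeetsH).Jhat i).subgroupOf (ofSpecialFibre X d S h36 Sigma SigmaHat hsub hne hprime hp TpH
      ((TpH.map (TemperedGraphGroupData.exists_completion_of_prop36 S.Gc h36
        S.chart).choose_spec.choose.toMonoidHom).topologicalClosure) (Subgroup.le_topologicalClosure _) cuspMeetsH).DeltaHat)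
    (h22 : (ofSpecialFibre X d S h36 Sigma SigmaHat hsub hne hprime hp TpH
      ((TpH.map (TemperedGraphGroupData.exists_completion_of_prop36 S.Gc h36
        S.chart).choose_spec.choose.toMonoidHom).topologicalClosure) (Subgroup.le_topologicalClosure _) cuspMeetsH).graph.CommensuratorsOfDecompositionSubgroups)
    (hHstab : ∀ g : X.PiTemp, ∃ t : S.chart.G,
      TpH.map (S.autOfConj P.admissibleKer_normal_pi g).toMulEquiv.toMonoidHom = MulAut.conj t • TpH) :
    (ofSpecialFibre X d S h36 Sigma SigmaHat hsub hne hprime hp TpH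
      ((TpH.map (TemperedGraphGroupData.exists_completion_of_prop36 S.Gc h36
        S.chart).choose_spec.choose.toMonoidHom).topologicalClosure) (Subgroup.le_topologicalClosure _) cuspMeetsH).Cor23i ∧
      (ofSpecialFibre X d S h36 Sigma SigmaHat hsub hne hprime hp TpH
      ((TpH.map (TemperedGraphGroupData.exists_completion_of_prop36 S.Gc h36
        S.chart).choose_spec.choose.toMonoidHom).topologicalClosure) (Subgroup.le_topologicalClosure _) cuspMeetsH).Cor23ii ∧
      (ofSpecialFibre X d S h36 Sigma SigmaHat hsub hne hprime hp TpH
      ((TpH.map (TemperedGraphGroupData.exists_completion_of_prop36 S.Gc h36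
        S.chart).choose_spec.choose.toMonoidHom).topologicalClosure) (Subgroup.le_topologicalClosure _) cuspMeetsH).Cor23iii ∧
      (ofSpecialFibre X d S h36 Sigma SigmaHat hsub hne hprime hp TpH
      ((TpH.map (TemperedGraphGroupData.exists_completion_of_prop36 S.Gc h36
        S.chart).choose_spec.choose.toMonoidHom).topologicalClosure) (Subgroup.le_topologicalClosure _) cuspMeetsH).Cor23iv :=
  cor23_i_to_iv_ofSpecialFibre_closureH_of_graphStable X d S h36 Sigma SigmaHat hsub hne hprime hp TpH
    cuspMeetsH h22 P.admissibleKer_normal_pi hHstab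
    (fun ha => kerLevel_all_ofSpecialFibre_of_towerLevels X d S h36 Sigma SigmaHat hsub hne hprime hp TpH
      ((TpH.map (TemperedGraphGroupData.exists_completion_of_prop36 S.Gc h36
        S.chart).choose_spec.choose.toMonoidHom).topologicalClosure) (Subgroup.le_topologicalClosure _)
      cuspMeetsH T P.N_cofinal (hA ha))
    (fun hb => kerLevel_all_ofSpecialFibre_of_towerLevels X d S h36 Sigma SigmaHat hsub hne hprime hp TpH
      ((TpH.map (TemperedGraphGroupData.exists_completion_of_prop36 S.Gc h36
        S.chart).choose_spec.choose.toMonoidHom).topologicalClosure) (Subgroup.le_topologicalClosure _)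
      cuspMeetsH T P.N_cofinal (hB hb))

/-- **[IUTchI] Cor. 2.3 (i)–(iv) AS TYPED at the genuine datum, print's `Π̂_ℍ :=` the closure of `Π^tp_ℍ`, over
the `PiData` record, for FINITE `Σ`** (the IUT application has `Σ = {l}`, [IUTchII] Prop. 2.2 p. 66):
binder list `{h22, hHstab, hA}` — the (b)-binder is redundant since a finite `Σ ∪ {p}` omits a prime
(`exists_prime_not_mem_of_finite`, `cor23iii_condA_of_condB`). [cite: Mochizuki2012, Cor 2.3 pp.47-49] -/
theorem cor23_i_to_iv_ofSpecialFibre_closureH_of_piData_of_finite (P : SpecialFibreTower.PiData X d S T)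
    (hfin : Sigma.Finite)
    (hA : (∃ l ∈ SigmaHat, l ∉ Sigma ∧ l ≠ p) →
      ∀ (i : ℕ) (a : (ofSpecialFibre X d S h36 Sigma SigmaHat hsub hne hprime hp TpH
      ((TpH.map (TemperedGraphGroupData.exists_completion_of_prop36 S.Gc h36
        S.chart).choose_spec.choose.toMonoidHom).topologicalClosure) (Subgroup.le_topologicalClosure _) cuspMeetsH).DeltaHat),
        (∀ x ∈ ((OfSpecialFibre.towerOfSpecialFibreTower X d T Sigma SigmaHat hsub hne hprime S h36 hp TpH
        ((TpH.map (TemperedGraphGroupData.exists_completion_of_prop36 S.Gc h36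
          S.chart).choose_spec.choose.toMonoidHom).topologicalClosure) (Subgroup.le_topologicalClosure _)
        cuspMeetsH).Jhat i).subgroupOf (ofSpecialFibre X d S h36 Sigma SigmaHat hsub hne hprime hp TpH
      ((TpH.map (TemperedGraphGroupData.exists_completion_of_prop36 S.Gc h36
        S.chart).choose_spec.choose.toMonoidHom).topologicalClosure) (Subgroup.le_topologicalClosure _) cuspMeetsH).DeltaHat,
          x ∈ (ofSpecialFibre X d S h36 Sigma SigmaHat hsub hne hprime hp TpH
      ((TpH.map (TemperedGraphGroupData.exists_completion_of_prop36 S.Gc h36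
        S.chart).choose_spec.choose.toMonoidHom).topologicalClosure) (Subgroup.le_topologicalClosure _) cuspMeetsH).ρHat.ker → a * x = x * a) →
        a ∈ ((OfSpecialFibre.towerOfSpecialFibreTower X d T Sigma SigmaHat hsub hne hprime S h36 hp TpH
        ((TpH.map (TemperedGraphGroupData.exists_completion_of_prop36 S.Gc h36
          S.chart).choose_spec.choose.toMonoidHom).topologicalClosure) (Subgroup.le_topologicalClosure _)
        cuspMeetsH).Jhat i).subgroupOf (ofSpecialFibre X d S h36 Sigma SigmaHat hsub hne hprime hp TpH
      ((TpH.map (TemperedGraphGroupData.exists_completion_of_prop36 S.Gc h36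
        S.chart).choose_spec.choose.toMonoidHom).topologicalClosure) (Subgroup.le_topologicalClosure _) cuspMeetsH).DeltaHat)
    (h22 : (ofSpecialFibre X d S h36 Sigma SigmaHat hsub hne hprime hp TpH
      ((TpH.map (TemperedGraphGroupData.exists_completion_of_prop36 S.Gc h36
        S.chart).choose_spec.choose.toMonoidHom).topologicalClosure) (Subgroup.le_topologicalClosure _) cuspMeetsH).graph.CommensuratorsOfDecompositionSubgroups)
    (hHstab : ∀ g : X.PiTemp, ∃ t : S.chart.G,
      TpH.map (S.autOfConj P.admissibleKer_normal_pi g).toMulEquiv.toMonoidHom = MulAut.conj t • TpH) :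
    (ofSpecialFibre X d S h36 Sigma SigmaHat hsub hne hprime hp TpH
      ((TpH.map (TemperedGraphGroupData.exists_completion_of_prop36 S.Gc h36
        S.chart).choose_spec.choose.toMonoidHom).topologicalClosure) (Subgroup.le_topologicalClosure _) cuspMeetsH).Cor23i ∧
      (ofSpecialFibre X d S h36 Sigma SigmaHat hsub hne hprime hp TpH
      ((TpH.map (TemperedGraphGroupData.exists_completion_of_prop36 S.Gc h36
        S.chart).choose_spec.choose.toMonoidHom).topologicalClosure) (Subgroup.le_topologicalClosure _) cuspMeetsH).Cor23ii ∧
      (ofSpecialFibre X d S h36 Sigma SigmaHat hsub hne hprime hp TpH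
      ((TpH.map (TemperedGraphGroupData.exists_completion_of_prop36 S.Gc h36
        S.chart).choose_spec.choose.toMonoidHom).topologicalClosure) (Subgroup.le_topologicalClosure _) cuspMeetsH).Cor23iii ∧
      (ofSpecialFibre X d S h36 Sigma SigmaHat hsub hne hprime hp TpH
      ((TpH.map (TemperedGraphGroupData.exists_completion_of_prop36 S.Gc h36
        S.chart).choose_spec.choose.toMonoidHom).topologicalClosure) (Subgroup.le_topologicalClosure _) cuspMeetsH).Cor23iv :=
  cor23_i_to_iv_ofSpecialFibre_closureH_of_piData X d S h36 Sigma SigmaHat hsub hne hprime hp TpH cuspMeetsH T P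
    hA (fun hb => hA (cor23iii_condA_of_condB (exists_prime_not_mem_of_finite hfin p) hb)) h22 hHstab

end Genuine

end StableCurveTemperedData

end Literature.IUT.HodgeTheaters

end
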